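import Summits.BirchSwinnertonDyer.BirchSwinnertonDyer.Theorems.AlignedTransportAtTwoMainConjectureOfRankZeroBSDAtTwoFineRoadLimDescent
import Summits.BirchSwinnertonDyer.BirchSwinnertonDyer.Theorems.AlignedTransportAtTwoMainConjectureOfRankZeroBSDAtTwoFineRoadNetDictionary
import Summits.BirchSwinnertonDyer.BirchSwinnertonDyer.Theorems.AlignedTransportAtTwoMainConjectureOfRankZeroBSDAtTwoFineRoad
import Literature.NumberTheory.EllipticCurves.DivisionField
import Literature.NumberTheory.EllipticCurves.FineSelmerClassGroupCriterion
import HarnessLib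

/-!
# Road (b″) netted: stub Limʳ `LimRelAtTwo` of line `birth` (skeleton v6) REDUCED TO ONE PRINTED DOOR — statement (A)
# UPSTAIRS over `ℚ(E[2], μ_{2^∞})` (Lim 2017 Thm. 3.5 at `p = 2` for the carrier `F = ℚ(E[2], √−1)`)

Cell `bsd-f1-sign2`, WIDTH-5 attach seat `bsd-line-att-p5` (gen 4) on line `birth` of crux C2
stmt-BirchSwinnertonDyer-22298 `MainConjectureOfRankZeroBSDAtTwo`; a `--supports 22298 --as helper` file, sequel of
`…FineRoadLimDescent` (the descent). HONEST FRAMING: THEOREMS ONLY — no definition, no named fact, no `sorry`; the door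
is a DISPLAYED hypothesis (`hLim`, `hup`), nothing is asserted about it; BSD is NOT proved by any of this.

* §3 (any `K`, `p`) the dual side for the relaxed-at-`∞` datum `Yr : W.FineSelmerDualDataRelaxedInf κ γ` (typer p600292):
  `isDualPair_relaxed`, `module_finite_relaxed_of_finite_pTorsion`, `finite_quotient_augIdealP_relaxed_of_finite_pTorsion`,
  **`lengthAt_relaxed_eq_zero_of_finite_pTorsion`**: `Sel₀^{rel ∞}(K_∞, E[p^∞])[p]` finite ⟹ `ℓ_{(p)}(Yr.X) = 0` (the
  relaxed twin of `…FineRoad.lengthAt_fineSelmerDual_eq_zero_of_finite_twoTorsion`).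
* §4 (`K = ℚ`, `p = 2`) the upstairs group `ker ρ̄_{E,2} ⊓ ker χ₂ = Gal(ℚ̄/ℚ(E[2], μ_{2^∞}))`
  (`ker_galoisRepTorsion_eq_fixingSubgroup_divisionField`; finite index in `ker κ`, `finiteIndex_upstairs_subgroupOf`),
  **`lengthAt_relaxed_eq_zero_of_upstairs_two`**: `Sel₀(ℚ(E[2], μ_{2^∞}), E[2^∞])[2]` finite ⟹ `ℓ₍₂₎(Yr.X) = 0` for every
  `Yr`, and **`limRelAtTwo_of_lim2017_upstairs`**: v6's `LimRelAtTwo` VERBATIM from the displayed door `hLim` = Lim 2017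
  Thm. 3.5 («if») at `p = 2` for `L = F = ℚ(E[2], √−1) = F(μ_{2p}, T/𝔪T)` itself — Iwasawa `μ₂ = 0` for `F^{cyc}` ⟹
  statement (A) for `E` over `F^{cyc} = ℚ(E[2], μ_{2^∞})` — the carrier on which Lim's printed proof needs no
  `2`-extension step and no narrow/wide class-group comparison (REF1-AUDIT §66; crux workfile NARROW-A2.md).

So, modulo typing that one door as a Literature fact, Limʳ is PRINT for BOTH signs of `Δ_W` (as the lead's v6 census
says), and the `Δ_W > 0` weight of road (b″) sits entirely in PFμ⁺ (`μ₂(ℚ(W[2], √−1)^{cyc}) = 0`) and MuIneqʳ.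

References: M. F. Lim, arXiv:1306.2047 §3 (Lemma 3.2, Thm. 3.5, proof of Thm. 3.1 «so that F contains μ_{2p}»);
J. Coates, R. Sujatha, Math. Ann. 331 (2005) §3; R. Greenberg, LNM 1716 (1999) §1 p. 60, §4 Lemma 4.6 (pp. 106–107).
-/

set_option autoImplicit false
-- the Theorems namespace of this sub repeats the summit name by design (D-0017 nested layout)
set_option linter.dupNamespace false

noncomputable section

open scoped Classical

namespace Summit.BirchSwinnertonDyer.BirchSwinnertonDyer.Theorems.AlignedTransportAtTwoFineRoad.LimRelUpstairs

open Literature.NumberTheory.EllipticCurves Literature.NumberTheory.GaloisRepresentations LimDescent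

universe u

/-! ## §3 The dual side: `Sel₀^{rel ∞}(K_∞)[p]` finite ⟹ `ℓ_{(p)}(X₀^{rel ∞}) = 0` for every relaxed dual datum -/

section Dual

open WeierstrassCurve Field Literature.NumberTheory.EllipticCurves.IwasawaModuleFinitePadicInt
  Literature.NumberTheory.EllipticCurves.Module Summit.BirchSwinnertonDyer.Rank1Residual.X1.MuLambda

variable {K : Type} [Field K] [NumberField K] (W : WeierstrassCurve K) {p : ℕ} [Fact p.Prime]
  (κ : ZpExtension K p) {γ : absoluteGaloisGroup K}

/-- Every class of `Sel₀^{rel ∞}(K_∞, E[p^∞])` is killed by a power of `p`. [cite: GreenbergLNM1716, §1 (after Conj. 1.3)] -/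
theorem exists_pow_smul_fineSelmerInftyRelaxedInf_eq_zero (s : W.fineSelmerInftyRelaxedInf κ) :
    ∃ k : ℕ, p ^ k • s = 0 := by
  obtain ⟨k, hk⟩ := W.exists_pow_smul_subgroupH1_ker_eq_zero κ (s : W.subgroupH1 p κ.kerSubgroup)
  exact ⟨k, Subtype.ext (by rw [AddSubgroupClass.coe_nsmul]; exact hk)⟩

/-- Every relaxed-at-`∞` dual fine Selmer datum is an axiomatic Pontryagin dual pair for `ψ = conj_γ − 1` on
`Sel₀^{rel ∞}` (the fields of the structure + `isLocNil_conjFineSelmerInftyRelaxedInf_sub_one`, typer p600292); the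
relaxed twin of `FineSelmerDualData.isDualPair`. [cite: GreenbergLNM1716, §1 p. 60 (after Conj. 1.3)] -/
theorem isDualPair_relaxed (hγ : κ.IsTopGenerator γ) (Yr : W.FineSelmerDualDataRelaxedInf κ γ) :
    IwasawaDual.IsDualPair p (W.conjFineSelmerInftyRelaxedInf κ γ - 1) Yr.toDual where
  bijective := Yr.bijective
  T_smul x s := by
    rw [Yr.toDual_T_smul, IwasawaDual.End_sub_apply, AddMonoid.End.one_apply, map_sub]
    rfl
  C_smul c x s k hk := Yr.toDual_C_smul c x s k hk
  locNil := W.isLocNil_conjFineSelmerInftyRelaxedInf_sub_one κ hγ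

/-- `X₀^{rel ∞}` is finitely generated over `Λ` once `Sel₀^{rel ∞}(K_∞, E[p^∞])[p]` is finite (Nakayama for duals,
`IsDualPair.module_finite`). [cite: GreenbergLNM1716, §1 p. 60 (after Conj. 1.3)] -/
theorem module_finite_relaxed_of_finite_pTorsion (hγ : κ.IsTopGenerator γ) (Yr : W.FineSelmerDualDataRelaxedInf κ γ)
    (hfin : Set.Finite {s : W.fineSelmerInftyRelaxedInf κ | p • s = 0}) :
    Module.Finite (IwasawaAlgebra p) Yr.X := by
  refine (isDualPair_relaxed W κ hγ Yr).module_finite (hfin.subset fun s hs ↦ ?_)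
  obtain ⟨hs1, -⟩ := hs
  rw [pow_one] at hs1
  exact hs1

/-- **`Sel₀^{rel ∞}(K_∞, E[p^∞])[p]` finite ⟹ `X₀^{rel ∞}/(p)X₀^{rel ∞}` finite** (exactness of Pontryagin duality at
`p`, `IwasawaDual.finite_quotient_pSmul_of_finite_pTorsion`). [cite: GreenbergLNM1716, §1 p. 60 (after Conj. 1.3)] -/
theorem finite_quotient_augIdealP_relaxed_of_finite_pTorsion (Yr : W.FineSelmerDualDataRelaxedInf κ γ)
    (hfin : Set.Finite {s : W.fineSelmerInftyRelaxedInf κ | p • s = 0}) :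
    Finite (Yr.X ⧸ (IwasawaAlgebra.augIdealP p • (⊤ : Submodule (IwasawaAlgebra p) Yr.X))) :=
  IwasawaDual.finite_quotient_pSmul_of_finite_pTorsion Yr.bijective Yr.toDual_C_smul
    (exists_pow_smul_fineSelmerInftyRelaxedInf_eq_zero W κ) hfin

/-- **Statement (A) in relaxed form kills the `(p)`-length of the relaxed dual**: if `Sel₀^{rel ∞}(K_∞, E[p^∞])[p]` is
finite then `ℓ_{(p)}(X₀^{rel ∞}(E/K_∞)) = 0` for every relaxed-at-`∞` dual fine Selmer datum with respect to a topological
generator (`X₀^{rel ∞}` finitely generated with finite `X₀^{rel ∞}/p`, hence torsion with `μ = 0`). The relaxed twin of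
`…FineRoad.lengthAt_fineSelmerDual_eq_zero_of_finite_twoTorsion`. [cite: CoatesSujatha2005, statement (A) (§3)]
[cite: GreenbergLNM1716, §1 p. 60 and §4 (PDF pp. 106–107)] -/
theorem lengthAt_relaxed_eq_zero_of_finite_pTorsion (hγ : κ.IsTopGenerator γ)
    (Yr : W.FineSelmerDualDataRelaxedInf κ γ) (hA : Set.Finite {s : W.fineSelmerInftyRelaxedInf κ | p • s = 0}) :
    lengthAt (IwasawaAlgebra p) Yr.X
      ⟨IwasawaAlgebra.augIdealP p, IwasawaAlgebra.isPrime_augIdealP_holds p⟩ = 0 := by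
  haveI : Module.Finite (IwasawaAlgebra p) Yr.X := module_finite_relaxed_of_finite_pTorsion W κ hγ Yr hA
  have hq := finite_quotient_augIdealP_relaxed_of_finite_pTorsion W κ Yr hA
  have hT : Module.IsTorsion (IwasawaAlgebra p) Yr.X := isTorsion_of_finite_quotient_augIdealP p Yr.X hq
  have hμ : muInvariant p Yr.X = 0 := muInvariant_eq_zero_of_finite_quotient_augIdealP p Yr.X hT hq
  have hne := lengthAt_ne_top_of_isTorsion p Yr.X hT
    ⟨IwasawaAlgebra.augIdealP p, IwasawaAlgebra.isPrime_augIdealP_holds p⟩ rfl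
  rw [muInvariant_eq_toNat_lengthAt p Yr.X
    ⟨IwasawaAlgebra.augIdealP p, IwasawaAlgebra.isPrime_augIdealP_holds p⟩ rfl] at hμ
  rcases ENat.toNat_eq_zero.mp hμ with h | h
  · exact h
  · exact absurd h hne

end Dual

/-! ## §4 `K = ℚ`, `p = 2`: the upstairs field `ℚ(E[2], μ_{2^∞}) = ℚ̄^{ker ρ̄_{E,2} ⊓ ker χ₂}` and the stub Limʳ -/

section RatTwo

open WeierstrassCurve NumberField IsDedekindDomain Field GreenbergSelmer
  Literature.NumberTheory.EllipticCurves.Module Literature.NumberTheory.IwasawaTheory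
  Literature.NumberTheory.EllipticCurves.Greenberg1999 Literature.NumberTheory.EllipticCurves.Rank1Residual
  Summit.BirchSwinnertonDyer.Rank1Residual Summit.BirchSwinnertonDyer.Rank1Residual.X1.MuLambda
  Summit.BirchSwinnertonDyer.Rank1Residual.F1Sign2
  Summit.BirchSwinnertonDyer.BirchSwinnertonDyer.Theorems.Rank1ResidualX1Defs
  Summit.BirchSwinnertonDyer.BirchSwinnertonDyer.Theses.AlignedTransportAtTwo

variable {K : Type} [Field K] [NumberField K]

omit [NumberField K] in
/-- `ker ρ̄_{E,n} = Gal(K̄/K(E[n]))` has FINITE INDEX in `Γ_K` (`E` elliptic, `n ≠ 0`): `Γ_K/ker ρ̄ ↪ Aut E[n]`, a finite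
group. [cite: SilvermanAEC2009, VIII.§1 (action of G_{K̄/K} on E[m])] -/
theorem finiteIndex_ker_galoisRepTorsion (W : WeierstrassCurve K) [W.IsElliptic] {n : ℕ} (hn : n ≠ 0) :
    (W.galoisRepTorsion (n : ℤ)).ker.FiniteIndex := by
  haveI : Finite (geomTorsion W (n : ℕ)) := W.finite_geomTorsion_nat hn
  haveI : Finite (AddAut (geomTorsion W (n : ℕ))) := Finite.of_injective _ DFunLike.coe_injective
  haveI : Finite (Multiplicative (AddAut (geomTorsion W (n : ℕ)))) := Finite.of_equiv _ Multiplicative.ofAdd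
  haveI : Finite (W.galoisRepTorsion (n : ℤ)).range := inferInstance
  haveI : Finite (absoluteGaloisGroup K ⧸ (W.galoisRepTorsion (n : ℤ)).ker) :=
    Finite.of_equiv _ (QuotientGroup.quotientKerEquivRange (W.galoisRepTorsion (n : ℤ))).symm.toEquiv
  exact Subgroup.finiteIndex_of_finite_quotient

omit [NumberField K] in
/-- `ker ρ̄_{E,n}` is the fixing group `Γ_{K(E[n])}` of the `n`-division field (`E` elliptic, `n ≠ 0`, `char K = 0`).
[cite: SilvermanAEC2009, VIII.§1] -/
theorem ker_galoisRepTorsion_eq_fixingSubgroup_divisionField [CharZero K] (W : WeierstrassCurve K) [W.IsElliptic]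
    (n : ℕ) [NeZero n] :
    (W.galoisRepTorsion (n : ℤ)).ker = (W.divisionField n).fixingSubgroup := by
  rw [W.fixingSubgroup_divisionField n]
  ext σ
  rw [MonoidHom.mem_ker, W.mem_fixingSubgroupOfModule_geomTorsion_iff n]
  constructor
  · intro h T
    rw [← W.galoisRepTorsion_apply, h]
    rfl
  · intro h
    apply Multiplicative.toAdd.injective
    ext T
    rw [W.galoisRepTorsion_apply, h T]
    rfl

variable (W : WeierstrassCurve ℚ) [W.IsElliptic] (κ : ZpExtension ℚ 2)

/-- `[Gal(ℚ̄/ℚ_∞) : Gal(ℚ̄/ℚ(E[2], μ_{2^∞}))] < ∞`: the upstairs group `ker ρ̄_{E,2} ⊓ ker χ₂` has finite index in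
`ker κ` for the cyclotomic `ℤ₂`-extension (`[ker κ : ker χ₂] < ∞`, att-p4 `InfRes.finiteIndex_ker_cyclotomicCharacter`;
`[Γ_ℚ : ker ρ̄_{E,2}] < ∞`). [cite: Washington1997, §13.1] [cite: SilvermanAEC2009, VIII.§1] -/
theorem finiteIndex_upstairs_subgroupOf (hκ : κ.IsCyclotomic) :
    (((W.galoisRepTorsion 2).ker ⊓ (GaloisRep.cyclotomicCharacter ℚ 2).toMonoidHom.ker).subgroupOf
      κ.kerSubgroup).FiniteIndex := by
  haveI := finiteIndex_ker_galoisRepTorsion W (n := 2) two_ne_zero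
  haveI := InfRes.finiteIndex_ker_cyclotomicCharacter κ hκ
  have h : ((W.galoisRepTorsion 2).ker ⊓ (GaloisRep.cyclotomicCharacter ℚ 2).toMonoidHom.ker).subgroupOf
      κ.kerSubgroup = ((W.galoisRepTorsion 2).ker).subgroupOf κ.kerSubgroup ⊓
        ((GaloisRep.cyclotomicCharacter ℚ 2).toMonoidHom.ker).subgroupOf κ.kerSubgroup := by
    ext x
    simp only [Subgroup.mem_subgroupOf, Subgroup.mem_inf]
  have e : (W.galoisRepTorsion ((2 : ℕ) : ℤ)).ker = (W.galoisRepTorsion 2).ker := rfl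
  rw [e] at *
  rw [h]
  infer_instance

/-- **Road (b″), stub Limʳ reduced to ONE upstairs (A)-statement.** For the cyclotomic `ℤ₂`-extension `ℚ_∞` of `ℚ`,
an elliptic `E/ℚ` and a topological generator `γ`: if the fine Selmer group of `E[2^∞]` over
`ℚ(E[2], μ_{2^∞}) = ℚ̄^{ker ρ̄_{E,2} ⊓ ker χ₂}` (Greenberg's strict Selmer group of the fine data; no real place
upstairs) has FINITE `2`-torsion — Coates–Sujatha's statement (A) for `E` over `F^{cyc}`, `F = ℚ(E[2], √−1)` — then
`ℓ₍₂₎(X₀^{rel ∞}(E/ℚ_∞)) = 0` for EVERY relaxed-at-`∞` dual fine Selmer datum `Yr` (typer p600292). Descent = Lim 2017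
Lemma 3.2 in kernel form (§1–§3). [cite: Lim2017FineSelmer, §3 Lemma 3.2 and Thm. 3.5 (arXiv:1306.2047 pp. 6–7)]
[cite: GreenbergLNM1716, §4 Lemma 4.6 (PDF pp. 106–107)] -/
theorem lengthAt_relaxed_eq_zero_of_upstairs_two (hκ : κ.IsCyclotomic) {γ : absoluteGaloisGroup ℚ}
    (hγ : κ.IsTopGenerator γ)
    (hup : Set.Finite {c : W.subgroupH1 2 ((W.galoisRepTorsion 2).ker ⊓ (GaloisRep.cyclotomicCharacter ℚ 2).toMonoidHom.ker) |
      c ∈ strictSelmerGroupOver ((W.galoisRepTorsion 2).ker ⊓ (GaloisRep.cyclotomicCharacter ℚ 2).toMonoidHom.ker)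
        (W.geomPrimaryTorsion 2) 2 (fineData (W.geomPrimaryTorsion 2) 2) ∧ 2 • c = 0})
    (Yr : W.FineSelmerDualDataRelaxedInf κ γ) :
    lengthAt (IwasawaAlgebra 2) Yr.X ⟨IwasawaAlgebra.augIdealP 2, IwasawaAlgebra.isPrime_augIdealP_holds 2⟩ = 0 :=
  lengthAt_relaxed_eq_zero_of_finite_pTorsion W κ hγ Yr
    (finite_pTorsion_fineRelaxed_of_upstairs W 2 κ hκ inf_le_right (finiteIndex_upstairs_subgroupOf W κ hκ) hup)

/-- **Stub Limʳ of line `birth` (skeleton v6, `LimRelAtTwo` VERBATIM) modulo ONE printed door.** The displayed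
hypothesis `hLim` is Lim 2017 Thm. 3.5 («if» direction) AT `p = 2` for the carrier `F = ℚ(E[2], √−1) = ℚ(μ₄, E[2])`
(Lim's `F(μ_{2p}, T/𝔪T)` itself — no `2`-extension step, no index hypothesis, no real place: REF1 §66, NARROW-A2): Iwasawa's
`μ₂ = 0` (growth form) for the cyclotomic `ℤ₂`-extension of `F` ⟹ statement (A) for `E` over
`F^{cyc} = ℚ(E[2], μ_{2^∞})`, as «`Sel₀(F^{cyc}, E[2^∞])[2]` finite». CONCLUSION: for every `W` (the stub's binders
`IsOrdinaryAt`, no rational `2`-torsion, `IsGloballyMinimal`, `IsCyclotomicVariable` are carried and unused), every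
`i` with `i² = −1`, the stub's `μ₂`-hypothesis on `ℚ(W[2], i)`, every cyclotomic datum and EVERY relaxed dual datum
`Yr`: `ℓ₍₂₎(Yr.X) = 0`. Nothing is asserted about `hLim`; BSD is not proved by any of this.
[cite: Lim2017FineSelmer, §3 Thm. 3.5, Lemma 3.2, proof of Thm. 3.1 (arXiv:1306.2047 pp. 6–7)]
[cite: CoatesSujatha2005, statement (A) and Thm. 3.4] [cite: GreenbergLNM1716, §4 Lemma 4.6 (PDF pp. 106–107)] -/
theorem limRelAtTwo_of_lim2017_upstairs
    (hLim : ∀ (W : WeierstrassCurve ℚ) [W.IsElliptic] (i : AlgebraicClosure ℚ), i ^ 2 = -1 →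
      (∀ κL : ZpExtension ↥(W.divisionField 2 ⊔ IntermediateField.adjoin ℚ {i}) 2,
        κL.IsCyclotomic → ClassicalMuVanishes κL) →
      Set.Finite {c : W.subgroupH1 2 ((W.galoisRepTorsion 2).ker ⊓ (GaloisRep.cyclotomicCharacter ℚ 2).toMonoidHom.ker) |
        c ∈ strictSelmerGroupOver ((W.galoisRepTorsion 2).ker ⊓ (GaloisRep.cyclotomicCharacter ℚ 2).toMonoidHom.ker)
          (W.geomPrimaryTorsion 2) 2 (fineData (W.geomPrimaryTorsion 2) 2) ∧ 2 • c = 0}) :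
    ∀ (W : WeierstrassCurve ℚ) [W.IsElliptic] [W.IsGloballyMinimal], IsOrdinaryAt W 2 →
      (∀ x : ℚ, ¬ HasRationalTwoTorsionX W x) →
      ∀ i : AlgebraicClosure ℚ, i ^ 2 = -1 →
      (∀ κL : ZpExtension ↥(W.divisionField 2 ⊔ IntermediateField.adjoin ℚ {i}) 2,
        κL.IsCyclotomic → ClassicalMuVanishes κL) →
      ∀ (κ : ZpExtension ℚ 2) (γ : Field.absoluteGaloisGroup ℚ), κ.IsCyclotomic →
      κ.IsTopGenerator γ → IsCyclotomicVariable 2 γ →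
      ∀ Yr : W.FineSelmerDualDataRelaxedInf κ γ,
        lengthAt (IwasawaAlgebra 2) Yr.X ⟨IwasawaAlgebra.augIdealP 2, IwasawaAlgebra.isPrime_augIdealP_holds 2⟩ = 0 := by
  intro W _ _ _ _ i hi hμ κ γ hκ hγ _ Yr
  exact lengthAt_relaxed_eq_zero_of_upstairs_two W κ hκ hγ (hLim W i hi hμ) Yr


/-! ## §5 APPEND (att-p5 g4, after the door landed as p605725): Limʳ from the NAMED FACT -/

/-- **Stub Limʳ `LimRelAtTwo` of line `birth` (skeletons v6/v7, VERBATIM) from the tree's named fact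
`Lim2017.thm35_at_two_upstairs_fineSelmer_twoTorsion_finite_of_classicalMuVanishes`** (Lim 2017 Thm. 3.5 at `p = 2`,
upstairs, carrier `F = ℚ(E[2], √−1)`; statement-only, p605725) and the kernel descent of this file and
`…FineRoadLimDescent`. So Limʳ is PRINT in the same sense as stub P: conditional on one named fact, for BOTH signs of
`Δ_W`; the lead may add the fact to `PublishedInputsAtTwo` and close `stub_limRelAtTwo` from stub P by this theorem.
Conditional (named-fact hypothesis); nothing else asserted; BSD is not proved by any of this.
[cite: Lim2017FineSelmer, §3 Thm. 3.5 and Lemma 3.2 (arXiv:1306.2047 pp. 6–7)] [cite: CoatesSujatha2005, statement (A) (§3)] -/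
theorem limRelAtTwo_of_lim2017
    (hLim : Lim2017.thm35_at_two_upstairs_fineSelmer_twoTorsion_finite_of_classicalMuVanishes) :
    ∀ (W : WeierstrassCurve ℚ) [W.IsElliptic] [W.IsGloballyMinimal], IsOrdinaryAt W 2 →
      (∀ x : ℚ, ¬ HasRationalTwoTorsionX W x) →
      ∀ i : AlgebraicClosure ℚ, i ^ 2 = -1 →
      (∀ κL : ZpExtension ↥(W.divisionField 2 ⊔ IntermediateField.adjoin ℚ {i}) 2,
        κL.IsCyclotomic → ClassicalMuVanishes κL) →
      ∀ (κ : ZpExtension ℚ 2) (γ : Field.absoluteGaloisGroup ℚ), κ.IsCyclotomic →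
      κ.IsTopGenerator γ → IsCyclotomicVariable 2 γ →
      ∀ Yr : W.FineSelmerDualDataRelaxedInf κ γ,
        lengthAt (IwasawaAlgebra 2) Yr.X ⟨IwasawaAlgebra.augIdealP 2, IwasawaAlgebra.isPrime_augIdealP_holds 2⟩ = 0 :=
  limRelAtTwo_of_lim2017_upstairs hLim


/-! ## §6 APPEND (att-p5 g4): the upstairs door also feeds the STRICT downstairs statement (A) (road (b)'s shape) -/

/-- `Sel₀ ≤ Sel₀^{rel ∞}`: finiteness of the `p`-torsion of the relaxed-at-`∞` fine Selmer group of `K_∞` gives that of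
the strict one (any number field, any `p`, any `ℤ_p`-extension). [cite: GreenbergLNM1716, §4 (PDF p. 106)] -/
theorem finite_pTorsion_fineSelmer_of_relaxed {K : Type} [Field K] [NumberField K] (V : WeierstrassCurve K) {p : ℕ}
    [Fact p.Prime] (κ' : ZpExtension K p) (h : Set.Finite {s : V.fineSelmerInftyRelaxedInf κ' | p • s = 0}) :
    Set.Finite {s : V.fineSelmerInfty κ' | p • s = 0} := by
  have himg : Set.Finite ((fun s : V.fineSelmerInftyRelaxedInf κ' ↦ (s : V.subgroupH1 p κ'.kerSubgroup)) ''
      {s : V.fineSelmerInftyRelaxedInf κ' | p • s = 0}) := h.image _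
  refine Set.Finite.of_finite_image (himg.subset ?_) Subtype.coe_injective.injOn
  rintro _ ⟨s, hs, rfl⟩
  have hs' : p • s = 0 := hs
  refine ⟨⟨(s : V.subgroupH1 p κ'.kerSubgroup), V.fineSelmerInfty_le_fineSelmerInftyRelaxedInf κ' s.2⟩, ?_, rfl⟩
  change p • (⟨(s : V.subgroupH1 p κ'.kerSubgroup), _⟩ : V.fineSelmerInftyRelaxedInf κ') = 0
  apply Subtype.ext
  show p • ((s : V.fineSelmerInfty κ') : V.subgroupH1 p κ'.kerSubgroup) = 0
  rw [← AddSubmonoidClass.coe_nsmul, hs', ZeroMemClass.coe_zero]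

/-- **The upstairs door implies the DOWNSTAIRS statement (A) at `(E, 2)` in the tree's `∃ γ D` form** (the conclusion
shape of `Lim2017.thm35_at_two_…_divisionField_four`, consumed by road (b) / `…FineRoad.finite_fineSelmer_twoTorsion_of_classicalMu`)
for the carrier `L = ℚ(E[2], √−1)`: upstairs (A) ⟹ `Sel₀^{rel ∞}(ℚ_∞)[2]` finite (descent) ⟹ `Sel₀(ℚ_∞)[2]` finite ⟹
`∃ γ D, X₀ f.g./ℤ₂` (tree `exists_fineSelmerDualData_moduleFinite_iff_finite_pTorsion`). So for this carrier the new
fact subsumes the old door's use, without the `2`-power-index bookkeeping `L ≤ ℚ(E[4])`. Displayed hypothesis; nothing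
asserted. [cite: Lim2017FineSelmer, §3 Thm. 3.5 and Lemma 3.2 (arXiv:1306.2047 pp. 6–7)] [cite: LimSujatha2018, §3 (before Prop. 3.2)] -/
theorem exists_fineSelmerDualData_moduleFinite_of_upstairs_two (hκ : κ.IsCyclotomic)
    (hup : Set.Finite {c : W.subgroupH1 2 ((W.galoisRepTorsion 2).ker ⊓ (GaloisRep.cyclotomicCharacter ℚ 2).toMonoidHom.ker) |
      c ∈ strictSelmerGroupOver ((W.galoisRepTorsion 2).ker ⊓ (GaloisRep.cyclotomicCharacter ℚ 2).toMonoidHom.ker)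
        (W.geomPrimaryTorsion 2) 2 (fineData (W.geomPrimaryTorsion 2) 2) ∧ 2 • c = 0}) :
    ∃ (γ : absoluteGaloisGroup ℚ) (D : W.FineSelmerDualData κ γ),
      Module.Finite ℤ_[2] (RestrictScalars ℤ_[2] (IwasawaAlgebra 2) D.X) := by
  obtain ⟨γ₀, hγ₀⟩ : ∃ γ₀ : absoluteGaloisGroup ℚ, κ.IsTopGenerator γ₀ := κ.surjective (Multiplicative.ofAdd 1)
  exact (IwasawaModuleFinitePadicInt.exists_fineSelmerDualData_moduleFinite_iff_finite_pTorsion W κ hγ₀).2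
    (finite_pTorsion_fineSelmer_of_relaxed W κ
      (finite_pTorsion_fineRelaxed_of_upstairs W 2 κ hκ inf_le_right (finiteIndex_upstairs_subgroupOf W κ hκ) hup))

/-- **Corollary (named-fact form).** `Lim2017.thm35_at_two_upstairs_…` ⟹ for every elliptic `E/ℚ`, every `i² = −1` with
Iwasawa `μ₂ = 0` for the cyclotomic `ℤ₂`-extensions of `ℚ(E[2], i)`, and every cyclotomic `κ`: statement (A) at `(E, 2)`
downstairs in the `∃ γ D` form. Conditional on the named fact; nothing else asserted.
[cite: Lim2017FineSelmer, §3 Thm. 3.5 and Lemma 3.2 (arXiv:1306.2047 pp. 6–7)] [cite: CoatesSujatha2005, statement (A) (§3)] -/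
theorem exists_fineSelmerDualData_moduleFinite_of_lim2017
    (hLim : Lim2017.thm35_at_two_upstairs_fineSelmer_twoTorsion_finite_of_classicalMuVanishes)
    (i : AlgebraicClosure ℚ) (hi : i ^ 2 = -1)
    (hμ : ∀ κL : ZpExtension ↥(W.divisionField 2 ⊔ IntermediateField.adjoin ℚ {i}) 2,
      κL.IsCyclotomic → ClassicalMuVanishes κL)
    (hκ : κ.IsCyclotomic) :
    ∃ (γ : absoluteGaloisGroup ℚ) (D : W.FineSelmerDualData κ γ),
      Module.Finite ℤ_[2] (RestrictScalars ℤ_[2] (IwasawaAlgebra 2) D.X) :=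
  exists_fineSelmerDualData_moduleFinite_of_upstairs_two W κ hκ (hLim W i hi hμ)


/-! ## §7 APPEND (att-p5 g4): the door's upstairs group IS `Gal(ℚ̄/F·ℚ_∞)`, `F = ℚ(E[2], √−1)` — kernel identification -/

/-- A `ℚ`-automorphism of `ℚ̄` fixes the field `ℚ(i)` pointwise iff it fixes `i`. [folklore] -/
theorem algEquiv_mem_fixingSubgroup_adjoin_simple_iff {i : AlgebraicClosure ℚ}
    (τ : AlgebraicClosure ℚ ≃ₐ[ℚ] AlgebraicClosure ℚ) :
    τ ∈ (IntermediateField.adjoin ℚ {i}).fixingSubgroup ↔ τ i = i := by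
  constructor
  · intro h
    exact (IntermediateField.mem_fixingSubgroup_iff _ τ).1 h i (IntermediateField.mem_adjoin_simple_self ℚ i)
  · intro h
    rw [← Subgroup.zpowers_le, ← IntermediateField.le_iff_le, IntermediateField.adjoin_le_iff,
      Set.singleton_subset_iff, SetLike.mem_coe, IntermediateField.mem_fixedField_iff]
    intro f hf
    have hle : Subgroup.zpowers τ ≤ MulAction.stabilizer (AlgebraicClosure ℚ ≃ₐ[ℚ] AlgebraicClosure ℚ) i :=
      Subgroup.zpowers_le.mpr (MulAction.mem_stabilizer_iff.mpr h)
    exact MulAction.mem_stabilizer_iff.mp (hle hf)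

/-- `σ ∈ Γ_ℚ` fixes `ℚ(i)` pointwise iff `σ • i = i` (the previous lemma through `absoluteGaloisGroup.toAlgEquiv`). [folklore] -/
theorem toAlgEquiv_mem_fixingSubgroup_adjoin_simple_iff {i : AlgebraicClosure ℚ} (σ : absoluteGaloisGroup ℚ) :
    Field.absoluteGaloisGroup.toAlgEquiv ℚ σ ∈ (IntermediateField.adjoin ℚ {i}).fixingSubgroup ↔ σ • i = i := by
  rw [Field.absoluteGaloisGroup.smul_def]
  exact algEquiv_mem_fixingSubgroup_adjoin_simple_iff (Field.absoluteGaloisGroup.toAlgEquiv ℚ σ)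

/-- **`Gal(ℚ̄/ℚ_∞) ∩ Gal(ℚ̄/ℚ(√−1)) = ker χ₂`** for the cyclotomic `ℤ₂`-extension `ℚ_∞ = ℚ̄^{ker κ}`: an element of `ker κ` has
`χ₂(σ) ∈ μ(ℤ₂) ⊆ {±1}` (`PadicInt.torsion_units_le_rootsOfUnity`), and `χ₂(σ) = −1` sends `i ↦ i³ = −i ≠ i`
(`GaloisRep.cyclotomicCharacter_spec`); conversely `ker χ₂ ≤ ker κ` fixes `μ₄ ∋ i`. I.e. `ℚ(√−1)·ℚ_∞ = ℚ(μ_{2^∞})`.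
[cite: Washington1997, §13.1] [cite: Serre1973, Ch. II §3.2 Prop. 8] -/
theorem kerSubgroup_inf_fixingSubgroup_adjoin_eq_kerCyc (hκ : κ.IsCyclotomic) {i : AlgebraicClosure ℚ}
    (hi : i ^ 2 = -1) :
    κ.kerSubgroup ⊓ (IntermediateField.adjoin ℚ {i}).fixingSubgroup =
      (GaloisRep.cyclotomicCharacter ℚ 2).toMonoidHom.ker := by
  have hi4 : i ^ 2 ^ 2 = 1 := by
    rw [show (2 : ℕ) ^ 2 = 2 * 2 from rfl, pow_mul, hi]; norm_num
  have hi0 : i ≠ 0 := by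
    rintro rfl
    norm_num at hi
  ext σ
  rw [Subgroup.mem_inf, MonoidHom.mem_ker]
  constructor
  · rintro ⟨hker, hfix'⟩
    have hfix : σ • i = i := (toAlgEquiv_mem_fixingSubgroup_adjoin_simple_iff σ).1 hfix'
    -- `χ₂(σ)` is a torsion unit of `ℤ₂`, hence `= ±1`
    have htor : GaloisRep.cyclotomicCharacter ℚ 2 σ ∈ CommGroup.torsion ℤ_[2]ˣ := by
      have h := hker
      rw [show κ.kerSubgroup = _ from hκ, Subgroup.mem_comap] at h
      exact h
    have h2 : Literature.NumberTheory.EllipticCurves.torsionOrder 2 = 2 := by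
      unfold Literature.NumberTheory.EllipticCurves.torsionOrder
        Literature.NumberTheory.EllipticCurves.cyclotomicExponent
      decide
    have hroot := PadicInt.torsion_units_le_rootsOfUnity htor
    rw [h2, mem_rootsOfUnity] at hroot
    have hsq : ((GaloisRep.cyclotomicCharacter ℚ 2 σ : ℤ_[2]ˣ) : ℤ_[2]) *
        ((GaloisRep.cyclotomicCharacter ℚ 2 σ : ℤ_[2]ˣ) : ℤ_[2]) = 1 := by
      rw [← Units.val_mul, ← pow_two, hroot, Units.val_one]
    rcases mul_self_eq_one_iff.mp hsq with h1 | h1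
    · exact Units.ext h1
    · -- `χ₂(σ) = -1`: then `σ i = i ^ 3 = -i ≠ i`
      exfalso
      have hspec := GaloisRep.cyclotomicCharacter_spec ℚ 2 (k := 2) σ i hi4
      rw [h1, map_neg, map_one] at hspec
      have hval : ((-1 : ZMod (2 ^ 2))).val = 3 := by decide
      rw [hval, hfix, pow_succ, hi] at hspec
      have h2i : (2 : AlgebraicClosure ℚ) * i = 0 := by linear_combination hspec
      rcases mul_eq_zero.mp h2i with h | h
      · norm_num at h
      · exact hi0 h
  · intro hker
    refine ⟨InfRes.ker_cyclotomicCharacter_le_kerSubgroup κ hκ (MonoidHom.mem_ker.mpr hker), ?_⟩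
    exact (toAlgEquiv_mem_fixingSubgroup_adjoin_simple_iff σ).2
      (GaloisRep.smul_eq_self_of_cyclotomicCharacter_eq_one ℚ 2 (σ := σ) hker 2 i hi4)

/-- **The door's upstairs group is the absolute Galois group of `F·ℚ_∞ = F^{cyc}`**, `F = ℚ(E[2], √−1)`, `ℚ_∞ = ℚ̄^{ker κ}`
the cyclotomic `ℤ₂`-extension: `Gal(ℚ̄/ℚ_∞) ∩ Gal(ℚ̄/F) = ker ρ̄_{E,2} ⊓ ker χ₂` — so the fine Selmer group in the conclusion of
`Lim2017.thm35_at_two_upstairs_fineSelmer_twoTorsion_finite_of_classicalMuVanishes` (p605725) is the one of `E` over the cyclotomic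
`ℤ₂`-extension of the SAME field `F = W.divisionField 2 ⊔ ℚ⟮i⟯` whose `ClassicalMuVanishes` is its hypothesis (KERNEL form of the
transcription «`F^{cyc} = ℚ(E[2], μ_{2^∞})`»). [cite: Washington1997, §13.1] [cite: SilvermanAEC2009, VIII.§1] -/
theorem kerSubgroup_inf_fixingSubgroup_sup_eq_upstairs (hκ : κ.IsCyclotomic) {i : AlgebraicClosure ℚ} (hi : i ^ 2 = -1) :
    κ.kerSubgroup ⊓ (W.divisionField 2 ⊔ IntermediateField.adjoin ℚ {i}).fixingSubgroup =
      (W.galoisRepTorsion 2).ker ⊓ (GaloisRep.cyclotomicCharacter ℚ 2).toMonoidHom.ker := by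
  have hsup := congrArg (fun S ↦ κ.kerSubgroup ⊓ S)
    (IntermediateField.fixingSubgroup_sup (K := W.divisionField 2) (L := IntermediateField.adjoin ℚ {i}))
  refine hsup.trans ?_
  have e : (W.galoisRepTorsion 2).ker = (W.divisionField 2).fixingSubgroup :=
    ker_galoisRepTorsion_eq_fixingSubgroup_divisionField W 2
  change κ.kerSubgroup ⊓ ((W.divisionField 2).fixingSubgroup ⊓ (IntermediateField.adjoin ℚ {i}).fixingSubgroup) =
    (W.galoisRepTorsion 2).ker ⊓ (GaloisRep.cyclotomicCharacter ℚ 2).toMonoidHom.ker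
  rw [inf_left_comm, kerSubgroup_inf_fixingSubgroup_adjoin_eq_kerCyc κ hκ hi, e]

end RatTwo

end Summit.BirchSwinnertonDyer.BirchSwinnertonDyer.Theorems.AlignedTransportAtTwoFineRoad.LimRelUpstairs

end
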